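import Summits.BirchSwinnertonDyer.BirchSwinnertonDyer.Theorems.SignedLowerHalvesSmallImageLowerHalfBothSignsRttCharRoadE1LocalCoresBridge
import Literature.NumberTheory.EllipticCurves.GreenbergVatsal2000.GreenbergSelmerGroups
import Literature.NumberTheory.EllipticCurves.SubgroupSelmerCocycleCriteriaProofs
import Summits.BirchSwinnertonDyer.BirchSwinnertonDyer.Theorems.QuadraticBranchSignedControlEtaLayerKummer
import HarnessLib

/-!
# Route `SignedLowerHalves`, crux L `SmallImageLowerHalfBothSigns` (stmt-BirchSwinnertonDyer-23599), line `rtt_w3` v12 — DESC AWAY FROM `p` for the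
# corestriction (LEAD cruxlead-23599 g7's ask (a), GLUE memo `Lines/rtt_w3-GLUE-g7.md` cut DESC): **`cor` of a class unramified at `v` (all conjugates)
# is unramified at `v` (all conjugates)**, for `v` unramified in `K` (its inertia group lies in `U = galRange K`).

Width seat `bsd-line-slh-p3-w3` g17 under LEAD `cruxlead-stmt-BirchSwinnertonDyer-23599` (cell `bsd-ssimc`; `--supports stmt-BirchSwinnertonDyer-23599 --as helper`).
THEOREMS ONLY (no definition, no named fact, no instance, no `sorry`); the unramified condition is Greenberg–Vatsal's (`GreenbergVatsal2000.unramifiedKer H M v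
= ker (H¹(H, M) → H¹(H ⊓ I_v, M))`, `unramifiedOutside H M p S₀` = all `Γ_k`-conjugates unramified at every `v ∉ S₀`, `v ∤ p`), the corestriction the tree's
explicit index-`2` transfer (`H1CorestrictionIndexTwo`), the class moved along `e : ↥(U.subgroupOf H) →ₜ* ↥(H ⊓ U)` (`…E1LocalCoresBridge`).
BSD / crux L / INJ are NOT proved here.

SETTING. `k` a number field, `H ≤ Γ_k` normal (`Γ_{k_n}`), `U ≤ Γ_k` normal (`galRange K`, index `2`), `N = U.subgroupOf H` with transversal `c₀ ∈ H`
(`hc`), `M` a discrete `Γ_k`-module, `v` a finite place with `I_v ≤ U` (`v` unramified in `K`; then every conjugate `σ⁻¹I_vσ ≤ U`).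
COMPUTATION. For `i ∈ H ∩ I_v` and `σ ∈ Γ_k`: `σ⁻¹iσ ∈ N`, so `(conj_σ cor ξ)(i) = σ·[ξ(σ⁻¹iσ) + c₀·ξ(c₀⁻¹σ⁻¹iσc₀)]`; the two arguments lie in the
inertia groups of the conjugates by `σ` and `σc₀`, where `ξ` is a coboundary (`m₁`, `m₂`) by hypothesis; hence `(conj_σ cor ξ)(i) = i(m₁+m₂) − (m₁+m₂)`.
* ★ `conjH1_corH1_resH1Hom_mem_unramifiedKer` — one place `v` with `I_v ≤ U`: all conjugates of `x ∈ H¹(↥(H ⊓ U), M)` unramified at `v` ⇒ all conjugates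
  of `cor (e^* x)` unramified at `v`.
* ★★ `corH1_resH1Hom_mem_unramifiedOutside` — `x ∈ unramifiedOutside (H ⊓ U) M p S₀` and `I_v ≤ U` for every `v ∉ S₀`, `v ∤ p` ⇒
  `cor (e^* x) ∈ unramifiedOutside H M p S₀`.

References: [GreenbergVatsal2000] §2 p. 17; [NeukirchSchmidtWingberg2008] I §5 (corestriction on cochains; double cosets); [SerreGaloisCohomology1997] I §2.5.
-/

set_option autoImplicit false
set_option linter.dupNamespace false -- D-0017: single-problem summit, the namespace repeats the problem name by design
noncomputable section

open scoped Classical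

universe u

namespace Summit.BirchSwinnertonDyer.BirchSwinnertonDyer.Theorems.SmallImageCharSignedSelmer

open NumberField IsDedekindDomain Field Literature.NumberTheory.EllipticCurves Literature.NumberTheory.GaloisRepresentations
  Literature.NumberTheory.EllipticCurves.GreenbergSelmer Literature.NumberTheory.EllipticCurves.GreenbergVatsal2000

section Away

variable {k : Type u} [Field k] [NumberField k] (H U : Subgroup (absoluteGaloisGroup k)) [H.Normal] [(U.subgroupOf H).Normal]
  (M : Type u) [AddCommGroup M] [DistribMulAction (absoluteGaloisGroup k) M] [TopologicalSpace M] [DiscreteTopology M]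

omit [NumberField k] [H.Normal] [(U.subgroupOf H).Normal] [TopologicalSpace M] [DiscreteTopology M] in
/-- An `e : ↥(U.subgroupOf H) →ₜ* ↥(H ⊓ U)` over `Γ_k` intertwines the two restricted actions on any `Γ_k`-module `M`. [folklore] -/
theorem smul_eq_smul_of_coe_eq' (e : (U.subgroupOf H) →ₜ* (H ⊓ U : Subgroup (absoluteGaloisGroup k)))
    (he : ∀ n : U.subgroupOf H, ((e n : (H ⊓ U : Subgroup (absoluteGaloisGroup k))) : absoluteGaloisGroup k) = ((n : H) : absoluteGaloisGroup k))
    (x : U.subgroupOf H) (m : M) : (AddMonoidHom.id M) (e x • m) = x • (AddMonoidHom.id M) m := by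
  simp only [AddMonoidHom.id_apply, Subgroup.smul_def, he]

/-- ★ **`cor` of a class unramified at `v` (all conjugates) is unramified at `v` (all conjugates)**, for a place `v` whose inertia group lies in `U`
(and `U` normal). Hypothesis: every `Γ_k`-conjugate of `x ∈ H¹(↥(H ⊓ U), M)` lies in `unramifiedKer (H ⊓ U) M v`; conclusion: every `Γ_k`-conjugate of
`corH1 (resH1Hom e id x) ∈ H¹(↥H, M)` lies in `unramifiedKer H M v`. See the module docstring for the two-coboundary computation.
[cite: GreenbergVatsal2000, §2 p. 17] [cite: NeukirchSchmidtWingberg2008, I §5] -/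
theorem conjH1_corH1_resH1Hom_mem_unramifiedKer [U.Normal] [(H ⊓ U).Normal]
    (e : (U.subgroupOf H) →ₜ* (H ⊓ U : Subgroup (absoluteGaloisGroup k)))
    (he : ∀ n : U.subgroupOf H, ((e n : (H ⊓ U : Subgroup (absoluteGaloisGroup k))) : absoluteGaloisGroup k) = ((n : H) : absoluteGaloisGroup k))
    (hN : IsOpen ((U.subgroupOf H : Subgroup H) : Set H)) (hM : ∀ m : M, Continuous fun g : H ↦ g • m)
    {c₀ : H} (hc : ∀ b : H, Xor (b * c₀⁻¹ ∈ U.subgroupOf H) (b ∈ U.subgroupOf H))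
    (v : HeightOneSpectrum (𝓞 k)) (hI : inertia v ≤ U) (x : subgroupH1 (H ⊓ U : Subgroup (absoluteGaloisGroup k)) M)
    (hx : ∀ τ : absoluteGaloisGroup k, conjH1 (H ⊓ U) M τ x ∈ unramifiedKer (H ⊓ U) M v) (σ : absoluteGaloisGroup k) :
    conjH1 H M σ (corH1 hN hM hc (resH1Hom e (AddMonoidHom.id M) (smul_eq_smul_of_coe_eq' H U M e he) x)) ∈ unramifiedKer H M v := by
  obtain ⟨ξ, rfl⟩ := oneCocycleClass_surjective _ x
  -- the two coboundary witnesses, at the conjugates by `σ` and by `σ c₀`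
  have hwit : ∀ τ : absoluteGaloisGroup k, ∃ m : M, ∀ y : inertiaIn (H ⊓ U) v,
      τ • ξ.1 (subgroupConj (H ⊓ U) τ (inertiaInToH (H ⊓ U) v y)) = ((y : decomp (K := k) v) : absoluteGaloisGroup k) • m - m := by
    intro τ
    have h := hx τ
    rw [conjH1_oneCocycleClass, GreenbergVatsal2000.unramifiedKer, AddMonoidHom.mem_ker, CocycleCriteria.resH1Hom_oneCocycleClass_eq_zero_iff] at h
    obtain ⟨m, hm⟩ := h
    exact ⟨m, fun y ↦ hm y⟩
  obtain ⟨m₁, hm₁⟩ := hwit σ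
  obtain ⟨m₂, hm₂⟩ := hwit (σ * c₀)
  -- unfold the class of `conj_σ cor (e^*ξ)`
  rw [EtaLayer.resH1Hom_oneCocycleClass, corH1_oneCocycleClass, conjH1_oneCocycleClass, GreenbergVatsal2000.unramifiedKer, AddMonoidHom.mem_ker,
    CocycleCriteria.resH1Hom_oneCocycleClass_eq_zero_iff]
  refine ⟨m₁ + m₂, fun y ↦ ?_⟩
  -- the element `g = y ∈ H ∩ I_v` and its conjugate `σ⁻¹ g σ ∈ N`
  have hgI : ((inertiaInToH H v y : H) : absoluteGaloisGroup k) ∈ inertia v := ((mem_inertiaIn_iff H v y).1 y.2).2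
  have hgH : ((inertiaInToH H v y : H) : absoluteGaloisGroup k) ∈ H := (inertiaInToH H v y).2
  have hmemN : subgroupConj H σ (inertiaInToH H v y) ∈ U.subgroupOf H := by
    rw [Subgroup.mem_subgroupOf, subgroupConj_apply_coe]
    have h := (inferInstance : U.Normal).conj_mem _ (hI hgI) σ⁻¹
    rwa [inv_inv] at h
  -- the same element seen in `H ⊓ U ∩ I_v`
  have hyHU : ((y : decomp (K := k) v) : absoluteGaloisGroup k) ∈ H ⊓ U := Subgroup.mem_inf.2 ⟨hgH, hI hgI⟩
  set ŷ : inertiaIn (H ⊓ U) v := ⟨(y : decomp (K := k) v), (mem_inertiaIn_iff (H ⊓ U) v _).2 ⟨hyHU, hgI⟩⟩ with hŷ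
  have e1 : e ⟨subgroupConj H σ (inertiaInToH H v y), hmemN⟩ = subgroupConj (H ⊓ U) σ (inertiaInToH (H ⊓ U) v ŷ) := by
    apply Subtype.ext
    rw [he, subgroupConj_apply_coe, subgroupConj_apply_coe]
    rfl
  have e2 : e (subgroupConj (U.subgroupOf H) c₀ ⟨subgroupConj H σ (inertiaInToH H v y), hmemN⟩) =
      subgroupConj (H ⊓ U) (σ * c₀) (inertiaInToH (H ⊓ U) v ŷ) := by
    apply Subtype.ext
    rw [he, subgroupConj_apply_coe, Subgroup.coe_mul, Subgroup.coe_mul, Subgroup.coe_inv, subgroupConj_apply_coe, subgroupConj_apply_coe,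
      mul_inv_rev]
    simp only [mul_assoc]
    rfl
  -- the values of `ξ` there are the two coboundaries
  have hξ1 : ξ.1 (subgroupConj (H ⊓ U) σ (inertiaInToH (H ⊓ U) v ŷ)) =
      σ⁻¹ • (((y : decomp (K := k) v) : absoluteGaloisGroup k) • m₁ - m₁) :=
    eq_inv_smul_iff.2 (hm₁ ŷ)
  have hξ2 : ξ.1 (subgroupConj (H ⊓ U) (σ * c₀) (inertiaInToH (H ⊓ U) v ŷ)) =
      (σ * c₀)⁻¹ • (((y : decomp (K := k) v) : absoluteGaloisGroup k) • m₂ - m₂) :=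
    eq_inv_smul_iff.2 (hm₂ ŷ)
  -- evaluate `conj_σ cor (e^*ξ)` at `y`
  rw [AddMonoidHom.id_apply, conjCocycle_apply, corCocycle_apply,
    show corFun hc _ (subgroupConj H σ (inertiaInToH H v y)) =
        corFun hc _ (((⟨subgroupConj H σ (inertiaInToH H v y), hmemN⟩ : U.subgroupOf H) : H)) from rfl,
    corFun_coe, symCocycle_apply, EtaLayer.pullback_resHomOfEquivariant_apply, EtaLayer.pullback_resHomOfEquivariant_apply,
    AddMonoidHom.id_apply, AddMonoidHom.id_apply, e1, e2, hξ1, hξ2, Subgroup.smul_def c₀, smul_smul,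
    show ((c₀ : H) : absoluteGaloisGroup k) * (σ * c₀)⁻¹ = σ⁻¹ by rw [mul_inv_rev, mul_inv_cancel_left], ← smul_add, smul_inv_smul,
    Subgroup.smul_def, Subgroup.smul_def, smul_add]
  abel

/-- ★★ **DESC away from `p`**: if `x ∈ H¹(↥(H ⊓ U), M)` is unramified outside `S₀ ∪ {p}` with all its conjugates (`unramifiedOutside (H ⊓ U) M p S₀`)
and every `v ∉ S₀`, `v ∤ p` has `I_v ≤ U` (unramified in `K`), then `cor (e^* x) ∈ unramifiedOutside H M p S₀`.
[cite: GreenbergVatsal2000, §2 pp. 16–17, 23] [cite: NeukirchSchmidtWingberg2008, I §5] -/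
theorem corH1_resH1Hom_mem_unramifiedOutside [U.Normal] [(H ⊓ U).Normal] (p : ℕ) (S₀ : Set (HeightOneSpectrum (𝓞 k)))
    (e : (U.subgroupOf H) →ₜ* (H ⊓ U : Subgroup (absoluteGaloisGroup k)))
    (he : ∀ n : U.subgroupOf H, ((e n : (H ⊓ U : Subgroup (absoluteGaloisGroup k))) : absoluteGaloisGroup k) = ((n : H) : absoluteGaloisGroup k))
    (hN : IsOpen ((U.subgroupOf H : Subgroup H) : Set H)) (hM : ∀ m : M, Continuous fun g : H ↦ g • m)
    {c₀ : H} (hc : ∀ b : H, Xor (b * c₀⁻¹ ∈ U.subgroupOf H) (b ∈ U.subgroupOf H))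
    (hI : ∀ v : HeightOneSpectrum (𝓞 k), v ∉ S₀ → ((p : ℕ) : 𝓞 k) ∉ v.asIdeal → inertia v ≤ U)
    (x : subgroupH1 (H ⊓ U : Subgroup (absoluteGaloisGroup k)) M) (hx : x ∈ unramifiedOutside (H ⊓ U) M p S₀) :
    corH1 hN hM hc (resH1Hom e (AddMonoidHom.id M) (smul_eq_smul_of_coe_eq' H U M e he) x) ∈ unramifiedOutside H M p S₀ := by
  rw [mem_unramifiedOutside_iff] at hx ⊢
  exact fun v hv hpv σ ↦ conjH1_corH1_resH1Hom_mem_unramifiedKer H U M e he hN hM hc v (hI v hv hpv) x (fun τ ↦ hx v hv hpv τ) σ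

end Away

end Summit.BirchSwinnertonDyer.BirchSwinnertonDyer.Theorems.SmallImageCharSignedSelmer

end
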